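import Summits.BirchSwinnertonDyer.Rank1Residual.X12.JZeroThreeDescent
import Summits.BirchSwinnertonDyer.Rank1Residual.X12.CubeSumSylvesterOddPart
import HarnessLib

/-!
# K12r@3 — an INFINITE WITNESS inside the leaf: Sylvester's cube-sum class 𝒞_HSY lies in
# `CornerF ∧ CMRamified` at `p = 3` and `BSD(·, 3)` holds on it, BY NAME, from print
# (cell `bsd-print-cfram`, seat p4)

HONEST FRAMING (cell `bsd-print-cfram`, run/shared/lean/pub/bsd-print-cfram/, D-0131 (2) print
tier; verbatim in every file of the seat): the cell works the partition leaf
`CornerF ∧ p ramified in the CM field K` (LADDER-BSD row K7r = B13; W-ALL row 12r) in PARTITION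
currency — a leaf or a cell counts only when its theorem is in the kernel BY NAME. The `p = 3` slice
`Summit.BirchSwinnertonDyer.WAllCornerFRamifiedAtThree` (CM by `ℚ(√−3)`, `ord_{s=1} L(E,s) = 1`,
`BSD(E,3)`) has NO class-wide theorem in print (bsd-wall-cm K12R3-SCOPING-v1 §3); the window
`N < 2·10⁴` is closed PER CLASS by certificate (`X12/JZeroThreeRecords*.lean`). THIS FILE records, by
name and from PUBLISHED theorems only, that the slice nevertheless contains a provably INFINITE
sub-family on which `BSD(·, 3)` is a theorem — Sylvester's class 𝒞_HSY: the cube-sum curves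
`E_p : x³ + y³ = p`, `p ≡ 4, 7 (mod 9)` prime with `3` not a cube mod `p` (Hu–Shu–Yin, Trans. AMS 372
(2019), Thms. 1.3–1.4 = tree fact `HuShuYin2019.thm14_threePart_product`; the rank-zero factor
`E_{3p²}` by Burungale–Flach 2024 Cor. 2 = `bsdTriple_of_hasCM_of_L_one_ne_zero`; modularity). The
composition `BSD(E_p, 3)` is the tree's `CubeSumFamilies.bsdp_three_of_thm14'` (cell `bsd-cm`);
what is added here is ONLY the leaf bookkeeping: every globally minimal `B ≅_ℚ E_p` satisfies the
three binders of `WAllCornerFRamifiedAtThree` (`HasCM`, `analyticRank = 1`, `CMRamified B 3`) and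
lies in `CornerF B 3` (`JZeroThree.cornerF_three_of_j_eq_zero`), and the leaf's conclusion
`BSDp B 3` — together with the exact order `#Ш(B/ℚ)[3^∞] = 1` printed by Hu–Shu–Yin — holds there.
So the leaf restricted to 𝒞_HSY is CLOSED by name; the class is infinite (Sylvester /
Dasgupta–Voight / Hu–Shu–Yin; Chebotarev in `ℚ(ζ₉, ∛3)`), which is the "infinite witness" of the
cell brief for the `@3` block. Nothing here is a Literature statement; no named fact is introduced;
beyond-print: NO (the `ℓ = 3` statement is Hu–Shu–Yin's; this is bookkeeping).

References: `X12/CubeSumSylvesterOddPart.lean` (`Sylvester.bsdp_of_model_of_ne_two`, cell bsd-cm);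
`X12/CubeSumFamilies.lean` (`bsdp_three_of_thm14'`); `X12/JZeroThreeDescent.lean` §1;
`WAll/TargetCMRamifiedSlices.lean`; [cite: HuShuYin2019, Thm. 1.3 and Thm. 1.4 (p. 3), §5];
[cite: BurungaleFlach2024, Cor. 2]; [cite: Miller2011LMS, §1 and Def. 1.1].
-/

set_option autoImplicit false

noncomputable section

open scoped Classical

open WeierstrassCurve Literature.NumberTheory.EllipticCurves
  Literature.NumberTheory.EllipticCurves.ModularForms
  Literature.NumberTheory.EllipticCurves.Rank1Residual
  Literature.NumberTheory.EllipticCurves.HuShuYin2019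
  Literature.NumberTheory.EllipticCurves.Rank1Residual.X12CubeSum

namespace Summit.BirchSwinnertonDyer.Rank1Residual.X12.JZeroThree

variable {p : ℕ}

/-- A model of the cube-sum curve `E_p : y² = x³ − 432p²` has `j = 0`. [folklore] -/
theorem j_eq_zero_of_model_cubeSum (B : WeierstrassCurve ℚ) [B.IsElliptic]
    (hB : ∃ C : VariableChange ℚ, C • B = cubeSumCurve (p : ℚ)) : B.j = 0 :=
  B.j_eq_zero (c₄_eq_zero_of_variableChange_eq hB)

/-- **𝒞_HSY lies in the leaf `CornerF ∧ CMRamified` at `3`.** For a prime `p ≡ 4, 7 (mod 9)` with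
`3` not a cube mod `p` and any globally minimal `B ≅_ℚ E_p`: the three binders of
`WAllCornerFRamifiedAtThree` hold — `B.HasCM`, `ord_{s=1} L(B, s) = 1` (Hu–Shu–Yin Thm. 1.3, inside
the fact `hHSY`), `CMRamified B 3` — and `(B, 3)` is a cell of the CM corner `CornerF`.
[cite: HuShuYin2019, Thm. 1.3 (p. 3)] -/
theorem sylvester_mem_leaf_three (hHSY : thm14_threePart_product)
    (hCM0 : bsdTriple_of_hasCM_of_L_one_ne_zero) (hmod : hasEntireLFunction_rat)
    (hp : p.Prime) (h9 : p % 9 = 4 ∨ p % 9 = 7) (h3 : ¬ ∃ x : ZMod p, x ^ 3 = 3)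
    (B : WeierstrassCurve ℚ) [B.IsElliptic] [B.IsGloballyMinimal]
    (hB : ∃ C : VariableChange ℚ, C • B = cubeSumCurve (p : ℚ)) :
    (B.HasCM ∧ B.analyticRank = 1 ∧ CMRamified B 3) ∧ CornerF B 3 := by
  have hr : B.analyticRank = 1 :=
    (CubeSumFamilies.bsdp_three_of_thm14' hHSY hCM0 hmod hp h9 h3 B hB).1
  exact ⟨leaf_hypotheses_of_j_eq_zero B (j_eq_zero_of_model_cubeSum B hB) hr,
    cornerF_three_of_j_eq_zero B (j_eq_zero_of_model_cubeSum B hB) hr⟩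

/-- **The leaf's conclusion on 𝒞_HSY, with the exact order: `BSD(B, 3)` and `#Ш(B/ℚ)[3^∞] = 1`**
for every globally minimal `B ≅_ℚ E_p`, `p ≡ 4, 7 (mod 9)` prime, `3` not a cube mod `p` — from
Hu–Shu–Yin Thm. 1.4 (`hHSY`; the rank-zero partner `E_{3p²}` is supplied by the EXISTENCE of a
globally minimal model, `CubeSumFamilies.exists_isGloballyMinimal_model`), Burungale–Flach Cor. 2
(`hCM0`) and modularity (`hmod`), through the tree's `CubeSumFamilies.bsdp_three_of_thm14'`.
[cite: HuShuYin2019, Thm. 1.4 (p. 3) and §5] [cite: BurungaleFlach2024, Cor. 2]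
[cite: Miller2011LMS, §1 and Def. 1.1] -/
theorem sylvester_bsdp_three_card (hHSY : thm14_threePart_product)
    (hCM0 : bsdTriple_of_hasCM_of_L_one_ne_zero) (hmod : hasEntireLFunction_rat)
    (hp : p.Prime) (h9 : p % 9 = 4 ∨ p % 9 = 7) (h3 : ¬ ∃ x : ZMod p, x ^ 3 = 3)
    (B : WeierstrassCurve ℚ) [B.IsElliptic] [B.IsGloballyMinimal]
    (hB : ∃ C : VariableChange ℚ, C • B = cubeSumCurve (p : ℚ)) :
    BSDp B 3 ∧ Nat.card (AddCommGroup.primaryComponent B.sha 3) = 1 := by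
  have hn : (3 * (p : ℚ) ^ 2) ≠ 0 :=
    mul_ne_zero (by norm_num) (pow_ne_zero _ (Nat.cast_ne_zero.mpr hp.ne_zero))
  haveI := CubeSumFamilies.isElliptic_cubeSumCurve hn
  obtain ⟨A, _, _, CA, hA⟩ :=
    CubeSumFamilies.exists_isGloballyMinimal_model (cubeSumCurve (3 * (p : ℚ) ^ 2))
  obtain ⟨-, -, -, -, -, -, -, hBtriv, -⟩ := hHSY p hp h9 h3 A B hB ⟨CA, hA⟩
  exact ⟨(CubeSumFamilies.bsdp_three_of_thm14' hHSY hCM0 hmod hp h9 h3 B hB).2.2, hBtriv⟩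

/-- **THE INFINITE WITNESS, in the leaf's own shape.** Granted Hu–Shu–Yin Thm. 1.4 (`hHSY`),
Burungale–Flach Cor. 2 (`hCM0`) and modularity (`hmod`): for every prime `p ≡ 4, 7 (mod 9)` with `3`
not a cube mod `p` and every globally minimal `B ≅_ℚ E_p`, the instance of
`WAllCornerFRamifiedAtThree` at `B` holds with all three of its hypotheses TRUE — `B.HasCM`,
`B.analyticRank = 1`, `CMRamified B 3` — and `BSDp B 3`. (The leaf itself, a statement about ALL CM
curves by `ℚ(√−3)` of analytic rank one, stays OPEN.) [cite: HuShuYin2019, Thm. 1.3 and Thm. 1.4 (p. 3)]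
[cite: BurungaleFlach2024, Cor. 2] -/
theorem sylvester_leaf_instance_three (hHSY : thm14_threePart_product)
    (hCM0 : bsdTriple_of_hasCM_of_L_one_ne_zero) (hmod : hasEntireLFunction_rat)
    (hp : p.Prime) (h9 : p % 9 = 4 ∨ p % 9 = 7) (h3 : ¬ ∃ x : ZMod p, x ^ 3 = 3)
    (B : WeierstrassCurve ℚ) [B.IsElliptic] [B.IsGloballyMinimal]
    (hB : ∃ C : VariableChange ℚ, C • B = cubeSumCurve (p : ℚ)) :
    B.HasCM ∧ B.analyticRank = 1 ∧ CMRamified B 3 ∧ BSDp B 3 := by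
  obtain ⟨⟨hcm, hr, hram⟩, -⟩ := sylvester_mem_leaf_three hHSY hCM0 hmod hp h9 h3 B hB
  exact ⟨hcm, hr, hram, (sylvester_bsdp_three_card hHSY hCM0 hmod hp h9 h3 B hB).1⟩

/-- The same for every globally minimal curve `ℚ`-ISOGENOUS to a model of `E_p` (the class 𝒞_HSY
as a union of isogeny classes): `ord_{s=1} L = 1 ∧ BSD(·, 3)`, by Cassels' invariance (`hCassels`,
tree `X12CubeSum.bsdp_three_of_isIsogenous`). At `ℓ = 3` this needs only Hu–Shu–Yin,
Burungale–Flach, modularity and Cassels (the all-odd-`ℓ` form `Sylvester.bsdp_of_isIsogenous_of_ne_two`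
also carries Li–Liu–Tian and Kobayashi for the other primes).
[cite: MilneADT2006, Thm. I.7.3] [cite: HuShuYin2019, Thm. 1.4 (p. 3)] -/
theorem sylvester_bsdp_three_of_isIsogenous (hHSY : thm14_threePart_product)
    (hCM0 : bsdTriple_of_hasCM_of_L_one_ne_zero) (hmod : hasEntireLFunction_rat)
    (hCassels : bsdRHS_eq_of_isIsogenous)
    (hp : p.Prime) (h9 : p % 9 = 4 ∨ p % 9 = 7) (h3 : ¬ ∃ x : ZMod p, x ^ 3 = 3)
    {B : WeierstrassCurve ℚ} [B.IsElliptic] [B.IsGloballyMinimal]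
    (hB : ∃ C : VariableChange ℚ, C • B = cubeSumCurve (p : ℚ))
    (W : WeierstrassCurve ℚ) [W.IsElliptic] [W.IsGloballyMinimal] (hiso : IsIsogenous W B) :
    W.analyticRank = 1 ∧ BSDp W 3 := by
  obtain ⟨hr, hfin, hb⟩ := CubeSumFamilies.bsdp_three_of_thm14' hHSY hCM0 hmod hp h9 h3 B hB
  exact X12CubeSum.bsdp_three_of_isIsogenous hCassels hmod hiso hr hfin hb

end Summit.BirchSwinnertonDyer.Rank1Residual.X12.JZeroThree

end
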